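import Summits.BirchSwinnertonDyer.BirchSwinnertonDyer.Theorems.PrintCf2RamifiedOffTYZQFormPsi
import HarnessLib

/-!
# Route `PrintCf2`, crux stmt-BirchSwinnertonDyer-20509 `RamifiedOffTYZOfFacts` — the Q-form identity (★) for `n ≡ 7 (mod 8)`: ODD FOREST LAYER
# (cell `bsd-print-cf2`, LEAD of 20509 g8, line `offtyz-v7`, cycle 9; kernel helpers `--supports stmt-BirchSwinnertonDyer-20509`)

First kernel layer of the proof of **(★)₇** — g5's Q-form identity `Q_n = q(κ_n)` in its Ω-form for square-free
`n = p₁⋯p_k ≡ 7 (mod 8)` (successor task named by the LEAD g7, crux workfile `Cruxes/RamifiedOffTYZOfFacts/Lines/offtyz_v7_MoverAssembly.md`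
§6 (a)). For `n ≡ 7 (mod 8)` the vector `y = ((−1/pᵢ)₊)` has `Σ y = 1` (and `Σ z = 0`, `z = ((2/pᵢ)₊)`), so g6's symmetric form
`bigN aᵀ univ z z z` of Monsky's matrix (valid for `Σ y = 0`) is replaced by the doubled matrix WITHOUT root weights,
`Ñ = bigN a D y z 0 = [[D_y, Pᵀ],[P, D_z]]` (`P = L_D`; for Monsky's data `P = Aᵀ`, and `Ñ = L·M_n·R` with unimodular `L, R` — sibling
bridge file). Everything here is ABSTRACT (arc weights `a` under the reciprocity law `a s t + a t s = y_s y_t`):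
* §1 the block weight `fwt a y z 0 B = (Σ_B y)·q_z(B)` (`= (Σ_B y)(Σ_B z)·κ(B)` on a flat odd block, `0` on an even block);
* §2 PARITY: `det Ñ_T = 0` whenever `Σ_T y ≠ Σ_T z` (`det_bigN_zero_root_eq_zero`; for Monsky's data: `s(n)` odd for `n ≡ 7 (8)`);
* §3–§5 **(★b)₇ in forest form**: for `Σ_D y = 1`, `Σ_D z = 0`,
  `adj(Ñ)_{(inl j)(inl j)} = Σ_{B ∋ j, Σ_B y = 0, Σ_B z = 1} κ_j(B) · det Ñ_{D∖B}` (`adjugate_bigN_zero_root_inl_inl_eq_sum_admissible`) —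
  the mark-copy cofactor is the pointed sum of `q_z(B)` (tree), the non-admissible pointed blocks die by parity, and the difference
  `Σ_{B adm} q_{z+e_j}(B)·det Ñ_{D∖B}` VANISHES (`sum_admissible_qwt_add_single_mul_det_eq_zero`: pinned expansion of the even block at `j`,
  the reciprocity lemma, and pointing the set exponential by the additive weight `y`, whose total on the complement is `0`).
The off-diagonal identity (★a)₇ is the sibling file `…QFormOddForestPair`. Pure linear algebra over `𝔽₂`; no number theory, no `sorry`.
BSD is not proved by any of this; no class is closed.

References: [cite: Chaiken1982, §2 (all minors matrix tree theorem)]; [cite: Smith2016CongruentDensity, §2 Prop. 2.4 and §2.2 case 5(b)];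
[cite: HeathBrown1994SelmerCongruentII, Appendix (Monsky), typescript p. 39 L27 – p. 40 L31].
-/

namespace Summit.BirchSwinnertonDyer.PrintCf2.QFormForest

open Matrix Finset Literature.LinearAlgebra.Matrix Literature.Combinatorics.Enumerative
open Literature.NumberTheory.EllipticCurves.Smith2016

variable {V : Type*} [Fintype V] [LinearOrder V]

/-! ## §1. The block weight without root weights -/

/-- `q_0(B) = 0` (no roots, no rooted forests). [cite: ChebotarevAgaev2002, §3 Thm. 2] -/
theorem qwt_zero_weight (a : V → V → ZMod 2) (B : Finset V) : qwt a 0 B = 0 := by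
  unfold qwt
  exact sum_eq_zero fun t _ => by rw [Pi.zero_apply, zero_mul]

/-- **`fwt a y z 0 B = (Σ_B y) · q_z(B)`**: without root weights a block of the forest formula is a tree with one `z`-root and one
`y`-mark. [cite: Chaiken1982, §2 (all minors matrix tree theorem: one root of W and one vertex of U per tree)] -/
theorem fwt_zero_root_apply (a : V → V → ZMod 2) (y z : V → ZMod 2) (B : Finset V) :
    fwt a y z 0 B = (∑ i ∈ B, y i) * qwt a z B := by
  rw [fwt, qwt_zero_weight, add_zero]

/-- An even block (`Σ_B y = 0`) weighs zero in `det [[D_y, Pᵀ],[P, D_z]]`. [cite: Chaiken1982, §2] -/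
theorem fwt_zero_root_of_even (a : V → V → ZMod 2) (y z : V → ZMod 2) {B : Finset V} (hyB : ∑ i ∈ B, y i = 0) :
    fwt a y z 0 B = 0 := by
  rw [fwt_zero_root_apply, hyB, zero_mul]

/-- **An odd block is flat**: under the reciprocity law on `B` with `Σ_B y = 1`, `fwt a y z 0 B = (Σ_B z) · κ_c(B)` for any `c ∈ B`.
[cite: Smith2016CongruentDensity, §2.2 (chunk p0008 L42–L50: for d ≡ 3 (4) all cofactors of the block agree)] -/
theorem fwt_zero_root_of_odd (a : V → V → ZMod 2) (y z : V → ZMod 2) {B : Finset V}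
    (hrec : ∀ i ∈ B, ∀ j ∈ B, i ≠ j → a i j + a j i = y i * y j) (hodd : ∑ i ∈ B, y i = 1) {c : V} (hc : c ∈ B) :
    fwt a y z 0 B = (∑ i ∈ B, z i) * treeDet a B c := by
  rw [fwt_zero_root_apply, hodd, one_mul, qwt_eq_sum_mul_treeDet_of_odd a y z hrec hodd hc]

/-! ## §2. Parity: `det [[D_y, Pᵀ],[P, D_z]] = 0` unless `Σ y = Σ z` -/

/-- **Parity theorem for the doubled matrix without root weights**: under the reciprocity law on `T`, if `Σ_T y ≠ Σ_T z` then
`det (bigN a T y z 0) = 0` — in the forest formula every block of a contributing set partition is odd with `Σ_C y = Σ_C z = 1`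
(§1), so the number of blocks is `≡ Σ_T y` and `≡ Σ_T z (mod 2)`. For Monsky's data (`Σ y = 1`, `Σ z = 0` when `n ≡ 7 (mod 8)`)
this is «`s(n)` is odd for `n ≡ 7 (mod 8)`». [cite: HeathBrown1994SelmerCongruentII, Appendix (Monsky), typescript p. 40 L1–L31 (s(D) odd for D ≡ 5, 6, 7 mod 8)]
[cite: Chaiken1982, §2] -/
theorem det_bigN_zero_root_eq_zero (a : V → V → ZMod 2) (y z : V → ZMod 2) :
    ∀ (T : Finset V), (∀ i ∈ T, ∀ j ∈ T, i ≠ j → a i j + a j i = y i * y j) →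
      (∑ i ∈ T, y i ≠ ∑ i ∈ T, z i) → (bigN a T y z 0).det = 0 := by
  suffices H : ∀ (n : ℕ) (T : Finset V), T.card = n → (∀ i ∈ T, ∀ j ∈ T, i ≠ j → a i j + a j i = y i * y j) →
      (∑ i ∈ T, y i ≠ ∑ i ∈ T, z i) → (bigN a T y z 0).det = 0 from fun T => H _ T rfl
  intro n
  induction n using Nat.strong_induction_on with
  | _ n ih =>
  intro T hn hrec hpar
  have hT : T.Nonempty := by
    rw [nonempty_iff_ne_empty]
    rintro rfl
    exact hpar (by rw [sum_empty, sum_empty])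
  obtain ⟨s, hs⟩ := hT
  rw [det_bigN_eq_setExp, setExp_peel _ hs]
  refine sum_eq_zero fun B₀ hB₀ => ?_
  rw [mem_powerset] at hB₀
  have hBT : insert s B₀ ⊆ T := insert_subset hs (hB₀.trans (erase_subset s T))
  have hsplit : ∀ f : V → ZMod 2, ∑ i ∈ T, f i = ∑ i ∈ insert s B₀, f i + ∑ i ∈ T.erase s \ B₀, f i :=
    fun f => sum_eq_sum_insert_add_sum_sdiff f hs hB₀
  have h01 : ∀ u : ZMod 2, u ≠ 1 → u = 0 := by decide
  by_cases hyB : ∑ i ∈ insert s B₀, y i = 1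
  swap
  · rw [fwt_zero_root_of_even a y z (h01 _ hyB), zero_mul]
  rw [fwt_zero_root_of_odd a y z (hrec_mono hBT hrec) hyB (mem_insert_self s B₀)]
  by_cases hzB : ∑ i ∈ insert s B₀, z i = 1
  swap
  · rw [h01 _ hzB, zero_mul, zero_mul]
  -- the rest inherits the disparity and is smaller
  have hparR : ∑ i ∈ T.erase s \ B₀, y i ≠ ∑ i ∈ T.erase s \ B₀, z i := by
    intro h
    apply hpar
    rw [hsplit y, hsplit z, hyB, hzB, h]
  have hRT : T.erase s \ B₀ ⊆ T := (sdiff_subset).trans (erase_subset s T)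
  have hcard : (T.erase s \ B₀).card < n := by
    rw [← hn]
    exact lt_of_le_of_lt (card_le_card sdiff_subset) (card_erase_lt_of_mem hs)
  rw [← det_bigN_eq_setExp, ih _ hcard _ rfl (hrec_mono hRT hrec) hparR, mul_zero]

/-! ## §3. The mark-copy cofactor as a sum over admissible blocks -/

/-- **Mark-copy cofactor of `Ñ = bigN a D y z 0` over admissible blocks** (shape of (★b)₇): under the reciprocity law on `D` with
`Σ_D y = 1`, `Σ_D z = 0`, `adj(Ñ)_{(inl j)(inl j)} = Σ_{B ∋ j, Σ_B y = 0, Σ_B z = 1} q_z(B) · det Ñ_{D∖B}` — in the tree's pointed forest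
sum (`adjugate_bigN_inl_inl`) a pointed block that is odd is flat (`q_z(B) = (Σ_B z) κ`), and whenever `(Σ_B y, Σ_B z) ≠ (0, 1)` either that
factor or the complement's determinant (parity, §2) vanishes. [cite: Chaiken1982, §2 (all minors matrix tree theorem)]
[cite: HeathBrown1994SelmerCongruentII, Appendix (Monsky), typescript p. 39 L27–L41] -/
theorem adjugate_bigN_zero_root_inl_inl_eq_sum_qwt (a : V → V → ZMod 2) (y z : V → ZMod 2) {D : Finset V}
    (hrec : ∀ i ∈ D, ∀ j ∈ D, i ≠ j → a i j + a j i = y i * y j) (hyD : ∑ i ∈ D, y i = 1) (hzD : ∑ i ∈ D, z i = 0)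
    {j : V} (hj : j ∈ D) :
    (bigN a D y z 0).adjugate (Sum.inl j) (Sum.inl j) =
      ∑ B₀ ∈ ((D.erase j).powerset).filter (fun B₀ => ∑ i ∈ insert j B₀, y i = 0 ∧ ∑ i ∈ insert j B₀, z i = 1),
        qwt a z (insert j B₀) * (bigN a (D.erase j \ B₀) y z 0).det := by
  rw [adjugate_bigN_inl_inl a hj, sum_filter]
  refine sum_congr rfl fun B₀ hB₀ => ?_
  rw [mem_powerset] at hB₀
  rw [← det_bigN_eq_setExp]
  have hBD : insert j B₀ ⊆ D := insert_subset hj (hB₀.trans (erase_subset j D))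
  have hRD : D.erase j \ B₀ ⊆ D := (sdiff_subset).trans (erase_subset j D)
  have hsplit : ∀ f : V → ZMod 2, ∑ i ∈ D, f i = ∑ i ∈ insert j B₀, f i + ∑ i ∈ D.erase j \ B₀, f i :=
    fun f => sum_eq_sum_insert_add_sum_sdiff f hj hB₀
  have h01 : ∀ u : ZMod 2, u ≠ 1 → u = 0 := by decide
  have h10 : ∀ u : ZMod 2, u ≠ 0 → u = 1 := by decide
  by_cases hy : ∑ i ∈ insert j B₀, y i = 0
  · by_cases hz : ∑ i ∈ insert j B₀, z i = 1
    · rw [if_pos ⟨hy, hz⟩]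
    · rw [if_neg (fun h => hz h.2)]
      -- the complement has `Σ y = 1`, `Σ z = 0`
      have hne : ∑ i ∈ D.erase j \ B₀, y i ≠ ∑ i ∈ D.erase j \ B₀, z i := by
        have hy' := hsplit y
        have hz' := hsplit z
        rw [hyD, hy, zero_add] at hy'
        rw [hzD, h01 _ hz, zero_add] at hz'
        rw [← hy', ← hz']
        exact one_ne_zero
      rw [det_bigN_zero_root_eq_zero a y z _ (hrec_mono hRD hrec) hne, mul_zero]
  · rw [if_neg (fun h => hy h.1)]
    have hy1 : ∑ i ∈ insert j B₀, y i = 1 := h10 _ hy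
    rw [qwt_eq_sum_mul_treeDet_of_odd a y z (hrec_mono hBD hrec) hy1 (mem_insert_self j B₀)]
    by_cases hz : ∑ i ∈ insert j B₀, z i = 1
    · -- the complement has `Σ y = 0`, `Σ z = 1`
      have hne : ∑ i ∈ D.erase j \ B₀, y i ≠ ∑ i ∈ D.erase j \ B₀, z i := by
        have hy' := hsplit y
        have hz' := hsplit z
        rw [hyD, hy1] at hy'
        rw [hzD, hz] at hz'
        have h2 : ∀ u v : ZMod 2, 1 = 1 + u → 0 = 1 + v → u ≠ v := by decide
        exact h2 _ _ hy' hz'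
      rw [det_bigN_zero_root_eq_zero a y z _ (hrec_mono hRD hrec) hne, mul_zero]
    · rw [h01 _ hz, zero_mul, zero_mul]

/-! ## §4. The correction term vanishes -/

omit [Fintype V] [LinearOrder V] in
/-- Sums over `{j} ∪ (E ∪ C)` split as `{j} ∪ E` plus `C` when `j ∉ C` and `E ∩ C = ∅`. [folklore] -/
theorem sum_insert_union_eq [DecidableEq V] (f : V → ZMod 2) {j : V} {E C : Finset V} (hjC : j ∉ C) (hEC : Disjoint E C) :
    ∑ i ∈ insert j (E ∪ C), f i = ∑ i ∈ insert j E, f i + ∑ i ∈ C, f i := by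
  rw [← insert_union, sum_union (disjoint_insert_left.mpr ⟨hjC, hEC⟩)]

/-- **The correction term of (★b)₇ vanishes**: under the reciprocity law on `D` with `Σ_D y = 1` and `j ∈ D` (no hypothesis on `z`),
`Σ_{B ∋ j, Σ_B y = 0, Σ_B z = 1} q_{z+e_j}(B) · det Ñ_{D∖B} = 0`. Proof: expand `q_{z+e_j}(B)` of the even block `B` by the pinned
all-minors expansion at `j` (`pinned_expansion_eq`, `Σ_B (z+e_j) = 0`): `= Σ_{j ∈ T ⊆ B} (Σ_T (z+e_j)) κ_j(T) setExp(q_y)(B∖T)`; by the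
reciprocity lemma `setExp(q_y)(C) = (Σ_C y) q_y(C)` the block `C = B∖T` must be odd, so `T` is odd with `Σ_T z = 0`, `C` is odd with
`Σ_C z = 1`, i.e. `(Σ_C y)·q_y(C) = (Σ_C y)·fwt a y z 0 C`; regrouping by `T`, the inner sum over `C` is the set exponential of
`fwt a y z 0` on `D∖T` pointed by the additive weight `y`, which equals `(Σ_{D∖T} y)·det Ñ_{D∖T} = 0`.
[cite: Chaiken1982, §2] [cite: Smith2016CongruentDensity, §2.2 case 5(b)] [cite: Stanley1999EC2, Cor. 5.1.6 (pointing a block of the exponential formula)] -/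
theorem sum_admissible_qwt_add_single_mul_det_eq_zero (a : V → V → ZMod 2) (y z : V → ZMod 2) {D : Finset V}
    (hrec : ∀ i ∈ D, ∀ j ∈ D, i ≠ j → a i j + a j i = y i * y j) (hyD : ∑ i ∈ D, y i = 1)
    {j : V} (hj : j ∈ D) :
    ∑ B₀ ∈ ((D.erase j).powerset).filter (fun B₀ => ∑ i ∈ insert j B₀, y i = 0 ∧ ∑ i ∈ insert j B₀, z i = 1),
      qwt a (fun i => z i + (Pi.single j (1 : ZMod 2) : V → ZMod 2) i) (insert j B₀) *
        (bigN a (D.erase j \ B₀) y z 0).det = 0 := by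
  set D₀ := D.erase j with hD₀
  set x : V → ZMod 2 := fun i => z i + (Pi.single j (1 : ZMod 2) : V → ZMod 2) i with hx
  set adm : Finset V → Prop := fun B₀ => ∑ i ∈ insert j B₀, y i = 0 ∧ ∑ i ∈ insert j B₀, z i = 1 with hadm
  have hjD₀ : j ∉ D₀ := notMem_erase j D
  have hD₀D : D₀ ⊆ D := erase_subset j D
  have h01 : ∀ u : ZMod 2, u ≠ 1 → u = 0 := by decide
  have h10 : ∀ u : ZMod 2, u ≠ 0 → u = 1 := by decide
  -- the value of `Σ_{insert j E} x`
  have hxsum : ∀ E : Finset V, j ∉ E → ∑ i ∈ insert j E, x i = ∑ i ∈ insert j E, z i + 1 := by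
    intro E hjE
    rw [hx, sum_add_distrib, sum_pi_single', if_pos (mem_insert_self j E)]
  -- Step 1: the pinned expansion of the even block at `j`
  have hpin : ∀ B₀ ∈ D₀.powerset.filter adm, qwt a x (insert j B₀) =
      ∑ E ∈ B₀.powerset, (∑ i ∈ insert j E, x i) * treeDet a (insert j E) j * setExp (qwt a y) (B₀ \ E) := by
    intro B₀ hB₀
    rw [mem_filter, mem_powerset] at hB₀
    have hjB₀ : j ∉ B₀ := fun h => hjD₀ (hB₀.1 h)
    have hBD : insert j B₀ ⊆ D := insert_subset hj (hB₀.1.trans hD₀D)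
    have h := pinned_expansion_eq a y x (hrec_mono hBD hrec) hB₀.2.1 (mem_insert_self j B₀)
    rw [erase_insert hjB₀, hxsum B₀ hjB₀, hB₀.2.2, CharTwo.add_self_eq_zero, zero_mul, add_zero] at h
    exact h.symm
  rw [sum_filter]
  have hite : ∀ B₀ ∈ D₀.powerset, (if adm B₀ then qwt a x (insert j B₀) * (bigN a (D₀ \ B₀) y z 0).det else 0) =
      ∑ E ∈ B₀.powerset, (if adm B₀ then 1 else 0) * ((∑ i ∈ insert j E, x i) * treeDet a (insert j E) j *
        setExp (qwt a y) (B₀ \ E) * (bigN a (D₀ \ B₀) y z 0).det) := by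
    intro B₀ hB₀
    by_cases h : adm B₀
    · rw [if_pos h, hpin B₀ (mem_filter.mpr ⟨hB₀, h⟩), sum_mul]
      refine sum_congr rfl fun E _ => ?_
      rw [if_pos h, one_mul]
    · rw [if_neg h]
      refine (sum_eq_zero fun E _ => ?_).symm
      rw [if_neg h, zero_mul]
  rw [sum_congr rfl hite, sum_powerset_sum_powerset_sub D₀]
  -- Step 2: for each `E`, the inner sum over the complement block `C` vanishes
  refine sum_eq_zero fun E hE => ?_
  rw [mem_powerset] at hE
  have hjE : j ∉ E := fun h => hjD₀ (hE h)
  have hTD : insert j E ⊆ D := insert_subset hj (hE.trans hD₀D)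
  have hinner : ∀ C ∈ (D₀ \ E).powerset,
      (if adm (E ∪ C) then 1 else 0) * ((∑ i ∈ insert j E, x i) * treeDet a (insert j E) j *
        setExp (qwt a y) ((E ∪ C) \ E) * (bigN a (D₀ \ (E ∪ C)) y z 0).det) =
      (∑ i ∈ insert j E, x i) * treeDet a (insert j E) j *
        ((if adm (E ∪ C) then 1 else 0) * setExp (qwt a y) C * setExp (fwt a y z 0) ((D₀ \ E) \ C)) := by
    intro C hC
    rw [mem_powerset] at hC
    rw [union_sdiff_cancel_left (disjoint_of_subset_right hC disjoint_sdiff), sdiff_sdiff_left, sup_eq_union,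
      det_bigN_eq_setExp]
    ring
  rw [sum_congr rfl hinner, ← mul_sum]
  -- the admissibility test splits along `{j} ∪ E` and `C`
  have hadmC : ∀ C ∈ (D₀ \ E).powerset, adm (E ∪ C) ↔
      (∑ i ∈ insert j E, y i + ∑ i ∈ C, y i = 0 ∧ ∑ i ∈ insert j E, z i + ∑ i ∈ C, z i = 1) := by
    intro C hC
    rw [mem_powerset] at hC
    have hjC : j ∉ C := fun h => hjD₀ (sdiff_subset (hC h))
    have hEC : Disjoint E C := disjoint_of_subset_right hC disjoint_sdiff
    change (∑ i ∈ insert j (E ∪ C), y i = 0 ∧ ∑ i ∈ insert j (E ∪ C), z i = 1) ↔ _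
    rw [sum_insert_union_eq y hjC hEC, sum_insert_union_eq z hjC hEC]
  by_cases hzT : ∑ i ∈ insert j E, z i = 1
  · -- `Σ_T x = 0`
    rw [hxsum E hjE, hzT, CharTwo.add_self_eq_zero, zero_mul, zero_mul]
  have hzT0 : ∑ i ∈ insert j E, z i = 0 := h01 _ hzT
  by_cases hyT : ∑ i ∈ insert j E, y i = 1
  swap
  · -- `T` even: an admissible `C` would be even AND nonempty-with-`Σ_C y = 1`; every term vanishes
    have hyT0 : ∑ i ∈ insert j E, y i = 0 := h01 _ hyT
    suffices h0 : ∑ C ∈ (D₀ \ E).powerset,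
        (if adm (E ∪ C) then 1 else 0) * setExp (qwt a y) C * setExp (fwt a y z 0) ((D₀ \ E) \ C) = 0 by
      rw [h0, mul_zero]
    refine sum_eq_zero fun C hC => ?_
    have hadm' := hadmC C hC
    rw [mem_powerset] at hC
    by_cases h : adm (E ∪ C)
    · rw [hadm', hyT0, hzT0, zero_add, zero_add] at h
      -- `Σ_C y = 0`, `Σ_C z = 1`: `C` is nonempty and `setExp(q_y)(C) = (Σ_C y) q_y(C) = 0`
      have hCne : C.Nonempty := nonempty_of_sum_eq_one h.2
      have hCD : C ⊆ D := hC.trans (sdiff_subset.trans hD₀D)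
      rw [setExp_qwt_eq_sum_mul_qwt a y hCne (hrec_mono hCD hrec), h.1, zero_mul, mul_zero, zero_mul]
    · rw [if_neg h, zero_mul, zero_mul]
  -- `T` odd with `Σ_T z = 0`: the admissible `C` are the odd blocks with `Σ_C z = 1`, weighted `q_y(C) = fwt a y z 0 C`
  have hterm : ∀ C ∈ (D₀ \ E).powerset,
      (if adm (E ∪ C) then 1 else 0) * setExp (qwt a y) C * setExp (fwt a y z 0) ((D₀ \ E) \ C) =
        (∑ i ∈ C, y i) * (fwt a y z 0 C * setExp (fwt a y z 0) ((D₀ \ E) \ C)) := by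
    intro C hC
    have hadm' := hadmC C hC
    rw [mem_powerset] at hC
    have hCD : C ⊆ D := hC.trans (sdiff_subset.trans hD₀D)
    rw [hyT, hzT0, zero_add] at hadm'
    by_cases hyC : ∑ i ∈ C, y i = 1
    · have hCne : C.Nonempty := nonempty_of_sum_eq_one hyC
      obtain ⟨c, hc⟩ := hCne
      rw [setExp_qwt_eq_sum_mul_qwt a y ⟨c, hc⟩ (hrec_mono hCD hrec), hyC, one_mul, one_mul,
        qwt_eq_sum_mul_treeDet_of_odd a y y (hrec_mono hCD hrec) hyC hc, hyC, one_mul,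
        fwt_zero_root_of_odd a y z (hrec_mono hCD hrec) hyC hc]
      have hiff : adm (E ∪ C) ↔ ∑ i ∈ C, z i = 1 := by
        rw [hadm', hyC, CharTwo.add_self_eq_zero]
        exact ⟨fun h => h.2, fun h => ⟨rfl, h⟩⟩
      by_cases h : adm (E ∪ C)
      · rw [if_pos h, hiff.mp h, one_mul]
      · rw [if_neg h, h01 _ (fun h' => h (hiff.mpr h')), zero_mul, zero_mul]
    · have hyC0 : ∑ i ∈ C, y i = 0 := h01 _ hyC
      have hna : ¬ adm (E ∪ C) := by
        rw [hadm', hyC0, add_zero]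
        exact fun h => one_ne_zero h.1
      rw [if_neg hna, hyC0, zero_mul, zero_mul, zero_mul]
  rw [sum_congr rfl hterm, setExp_point y (fwt a y z 0) (D₀ \ E)]
  -- the complement `D₀ ∖ E = D ∖ T` has `Σ y = 0`
  have hyW : ∑ i ∈ D₀ \ E, y i = 0 := by
    have h := sum_eq_sum_insert_add_sum_sdiff y hj (show E ⊆ D.erase j from hE)
    rw [hyD, hyT] at h
    have h2 : ∀ u : ZMod 2, 1 = 1 + u → u = 0 := by decide
    exact h2 _ h
  rw [hyW, zero_mul, mul_zero]

/-! ## §5. (★b)₇ in forest form -/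

/-- **(★b)₇, forest form**: under the reciprocity law on `D` with `Σ_D y = 1`, `Σ_D z = 0` and `j ∈ D`, the mark-copy cofactor of
`Ñ = bigN a D y z 0` is `adj(Ñ)_{(inl j)(inl j)} = Σ_{B ∋ j, Σ_B y = 0, Σ_B z = 1} κ_j(B) · det Ñ_{D∖B}`. For Monsky's data
(`n = p₁⋯p_k ≡ 7 (mod 8)`, `aᵀ s t = A_{ts}`) the left side is `κ_n(inr j) = kappaB p j` (bridge file) and the right side re-indexes to
`Ω_{jj}` — the diagonal clause of g5's `QFormIdentityOmega` at `∏ pᵢ ≡ 7 (mod 8)`. [cite: Chaiken1982, §2 (all minors matrix tree theorem)]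
[cite: HeathBrown1994SelmerCongruentII, Appendix (Monsky), typescript p. 39 L27–L41] [cite: Smith2016CongruentDensity, §2.2 case 5(b)] -/
theorem adjugate_bigN_zero_root_inl_inl_eq_sum_admissible (a : V → V → ZMod 2) (y z : V → ZMod 2) {D : Finset V}
    (hrec : ∀ i ∈ D, ∀ j ∈ D, i ≠ j → a i j + a j i = y i * y j) (hyD : ∑ i ∈ D, y i = 1) (hzD : ∑ i ∈ D, z i = 0)
    {j : V} (hj : j ∈ D) :
    (bigN a D y z 0).adjugate (Sum.inl j) (Sum.inl j) =
      ∑ B₀ ∈ ((D.erase j).powerset).filter (fun B₀ => ∑ i ∈ insert j B₀, y i = 0 ∧ ∑ i ∈ insert j B₀, z i = 1),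
        treeDet a (insert j B₀) j * (bigN a (D.erase j \ B₀) y z 0).det := by
  rw [adjugate_bigN_zero_root_inl_inl_eq_sum_qwt a y z hrec hyD hzD hj]
  have h0 := sum_admissible_qwt_add_single_mul_det_eq_zero a y z hrec hyD hj
  have hsplit : ∀ B₀ ∈ ((D.erase j).powerset).filter (fun B₀ => ∑ i ∈ insert j B₀, y i = 0 ∧ ∑ i ∈ insert j B₀, z i = 1),
      qwt a (fun i => z i + (Pi.single j (1 : ZMod 2) : V → ZMod 2) i) (insert j B₀) * (bigN a (D.erase j \ B₀) y z 0).det =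
        qwt a z (insert j B₀) * (bigN a (D.erase j \ B₀) y z 0).det +
          treeDet a (insert j B₀) j * (bigN a (D.erase j \ B₀) y z 0).det := by
    intro B₀ _
    rw [qwt_add_single a z (mem_insert_self j B₀), add_mul]
  rw [sum_congr rfl hsplit, sum_add_distrib] at h0
  have h2 : ∀ u v : ZMod 2, u + v = 0 → u = v := by decide
  exact h2 _ _ h0

end Summit.BirchSwinnertonDyer.PrintCf2.QFormForest
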